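import Literature.MathematicalPhysics.QuantumFieldTheory.Balaban1983to89.B5Hk163RatePosition

/-!
# Bałaban 1984 (B5) (1.63) in position space, II: η-rate of Hölder difference quotients at
# perturbed base points (the bookkeeping step of King 1986 §4 (4.27)/(4.28))

HONEST FRAMING (page 1). This module is a piece of the LINEAR THEORY of the spine estimate NE2
(η-rate) at rung (B)+1: FINITE TORUS, trivial background `U = 1`, general dimension `d ≥ 1`.
It adds to `B5Hk163RatePosition` the one routine step that module left to the assembler (its
WHAT IS NOT CLAIMED (ii)): passing from the Hölder modulus of the level difference at COMMON base
points (`kerFib_rate_holder`) to the difference of `α`-Hölder quotients taken at DIFFERENT, nearby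
base points `(x, y)` and `(x′, y′)` — King's replacement of `x, y` by nearby points of the other
lattice.  The step is pure real analysis on `ℝ^d` (a Hölder function's quotients move little when
the base points move little) plus the triangle inequality.  It is NOT an infinite-volume statement,
NOT a mass-gap statement, NOT progress on any Clay problem, and it does NOT identify the
trigonometric kernels `kerFib` with operator kernels of Bałaban's `H_k` (WHAT IS NOT CLAIMED (i)).

## The objects

* `HQ α f x y = ‖x − y‖₁^{−α} · (f x − f y)` — the `α`-Hölder difference quotient of
  `f : ℝ^d → ℂ` in the ℓ¹ distance `l1` of the parent (`= 0` for `x = y`).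
* `Hmod d β = 2^{1−β} (C0maj d · π^{1+β} + C1maj d · aliasConst d β)` — the level-uniform Hölder
  constant of the fixed-fibre kernels `kerFib n μ λ ν p′` at exponent `β` (`kerFib_holder_le`).

## What is proved (all `[folklore]`)

* §1 ℓ¹ triangle facts: `abs_l1_sub_l1_le`, `l1_add_le`, `l1_neg`, and the base-point
  perturbation of the distance `abs_dist_sub_dist_le`:
  `|‖x − y‖₁ − ‖x′ − y′‖₁| ≤ ‖x − x′‖₁ + ‖y − y′‖₁` (the ℓ¹ form of the role of King's (4.27)).
* §2 GENERIC: for an `(α+γ)`-Hölder `f` (`‖f u − f v‖ ≤ H ‖u − v‖₁^{α+γ}`, `0 ≤ α`, `0 < γ`,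
  `α + γ ≤ 1`): `norm_HQ_le` (`‖HQ α f x y‖ ≤ H ‖x − y‖₁^γ`), the elementary prefactor bound
  `rpow_neg_sub_rpow_neg_le` (`b^{−α} − a^{−α} ≤ b^{−α}(a − b)/a` for `0 < b ≤ a`, `α ≤ 1`, from
  `t ≤ t^α` on `[0,1]` — no mean-value theorem), and the perturbation theorem `HQ_perturb_le`:
  `‖x − x′‖₁, ‖y − y′‖₁ ≤ δ ⟹ ‖HQ α f x y − HQ α f x′ y′‖ ≤ 6 H δ^γ` (near case `‖x − y‖₁ ≤ 2δ`:
  the two quotients are `≤ H(2δ)^γ ≤ 2Hδ^γ` and `≤ H(4δ)^γ ≤ 4Hδ^γ`, whence the `6`; far case: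
  split off the prefactor difference, each of the two pieces is `≤ 2Hδ^γ`).
* §3 APPLICATION to the (1.63) kernels across the levels `N → R·N` on a fixed non-zero fibre:
  `Hmod_nonneg`, `T163_div_nonneg` (signs read off from the parents' bounds), the level part at
  common base points `HQ_kerFib_level_le` (`≤ 2^{1−α} T163(d,α,γ) N^{−γ}`), and THE PACKAGED RATE
  `kerFib_HQ_rate`: for `0 ≤ α`, `0 < γ`, `α + γ < 1`, `δ > 0`, `‖x − x′‖₁, ‖y − y′‖₁ ≤ δ`,
  `‖HQ α K^{(N)} (x,y) − HQ α K^{(RN)} (x′,y′)‖ ≤ 2^{1−α} T163(d,α,γ) N^{−γ} + 6 Hmod(d,α+γ) δ^γ`,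
  with the scaled form `kerFib_HQ_rate_scaled` (`δ = c/N`: right side
  `(2^{1−α} T163 + 6 Hmod c^γ) N^{−γ}`).  Uniform in `x, y, x′, y′ ∈ ℝ^d`, the fibre, `R ≥ 1`.

## Sources (locations only; every declaration is `[folklore]`, no constant is attributed to print)

[cite: King1986, p.673 (4.27)–(4.28)] «Furthermore, when |x−y| > L^{−k}, we have
||x−y| − |x′−y′|| ≦ L^{−k}. (4.27) Therefore it follows easily that ||x−y|^{−α}{1 − exp[i(p′+l)
(y−x)]} − |x′−y′|^{−α}{1 − exp[i(p′+l)(y′−x′)]}| ≦ CL^{−γk}|p′+l|^{α+γ}, (4.28) where we have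
assumed α + γ < 1 and γ ≦ α.» (page read as an image from
`HOME/b2b-balaban-template/king-renders/1986-cmp102-king-u1-higgs-I-p025-x2.png`; the same
passage is quoted in the parent.)  DICTIONARY (analogue, not instance): King's Euclidean `|x − y|`
↦ the ℓ¹ distance `‖x − y‖₁ = l1 (x − y)` (all norms on `ℝ^d` are equivalent; only `d`-dependent
constants change); `L^{−k}` ↦ `N^{−1}`, the proximity `|x − x′|, |y − y′| ≤ c L^{−k}` of the
replacement points ↦ the hypothesis `‖x − x′‖₁, ‖y − y′‖₁ ≤ δ` (`δ = c/N` in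
`kerFib_HQ_rate_scaled`); King's PER-MODE inequality (4.28) for `{1 − exp[i(p′+l)(y−x)]}` with
the weight `|p′+l|^{α+γ}` ↦ our FUNCTION-LEVEL statement for the whole kernel `K = kerFib`, whose
`(α+γ)`-Hölder constant `Hmod(d, α+γ)` is `2^{1−(α+γ)}` times the parent's BOUND
`C0maj·π^{1+α+γ} + C1maj·aliasConst_d(α+γ)` for the `|q̃|^{α+γ}`-weighted alias sum
(`kerFib_holder_le` ← `sum_h163_weighted_le` at exponent `α+γ < 1`) — the triangle inequality
commutes with the alias sum, so packaging after summation loses nothing at the level of bounds.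
King's side condition «γ ≦ α» is not needed in this organisation (near/far split at
`‖x − y‖₁ = 2δ`, level difference taken at common base points first); we do not claim to
reproduce the constants or the internal order of King's argument, only its output shape.
[cite: King1986, p.672 (4.19)] and [cite: Balaban1984PropagatorsI, p.29, after (1.63)] enter only
through the parents (quoted verbatim there).

[cite: King1986, p.664 Proposition 3.8 (3.71), lines 3–4, and the sentence before it] «When
x′ ∈ T_{η′}, we denote by x that point in T_η for which x′ ∈ B^n(x). Proposition 3.8. For x′,
y′ ∈ T_{η′}, 0 < α < 1, and γ sufficiently small, … |(∂_α(x′, y′)a_{k+n}G^{η′}_{k+n}Q^*_{k+n})(z)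
− (∂_α(x, y)a_kG^η_kQ^*_k)(z)|, |(∂_α(x′, y′)a_{k+n}∂^{η′}_μ G^{η′}_{k+n}Q^*_{k+n})(z) − (∂_α(x, y)
a_k∂^η_μG^η_kQ^*_k)(z)| ≦ CL^{−γk} exp[−δ₀{|x − z|, dist({x, y}, z)}]. (3.71)» (page read as an
image from `HOME/b2b-balaban-template/king-renders/1986-cmp102-king-u1-higgs-I-p016-x2.png`).
This is the STATEMENT (for King's scalar `a_k G_k Q_k^*`) that the passage (4.27)/(4.28) serves;
it is quoted as a LOCATION only.  DICTIONARY, continued: «x′ ∈ B^n(x)» (the fine point lies in the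
averaging block of the coarse point, a set of diameter `≍ L^{−k}`) ↦ our `‖x − x′‖₁, ‖y − y′‖₁ ≤ δ`
with `δ = c/N`.  NOT CLAIMED HERE: the decay factor `exp[−δ₀{|x − z|, dist({x, y}, z)}]` of
(3.71) — the bounds of this module and of its parents are pure sup bounds in the position
variables, uniform but WITHOUT decay; in King's proof the decay comes from shifting the
`p′`-integration into the complex strip, which is not part of this lineage's modules.

## WHAT IS NOT CLAIMED

(i) As in the parent: `kerFib` is a trigonometric polynomial BUILT FROM the multiplier family
`B5Hk163Strip.h163`; its identification with the kernel `(∂_ν H_k)(x, y)` of Bałaban's `H_k` on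
`T_η` (operator-level B5 (1.63), `R ∂^* G Q^* = 0`) is the open dictionary item of the b05 lineage
(GAPS G-b05g10-4) and is not touched.
(ii) King's (4.28) as printed (per alias mode, Euclidean norm, his constants and his case split at
`|x − y| = L^{−k}`) is NOT transcribed; what is proved is the function-level analogue in the ℓ¹
distance that a kernel bound of the (3.71) type consumes.  Which points `x′, y′` the reader chooses
(nearest points of the coarser lattice, block centres, …) is the reader's; any `δ > 0` is allowed.
(iii) The zero fibre `p′ = 0` is excluded by hypothesis (`p′_{ν₀} ≠ 0`), as in the parents.
(iv) No fibre sum is re-done here: `B5Hk163RatePosition` §6 shows the pattern (`≤ |S| ·` the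
fixed-fibre bound for coefficients of modulus `≤ 1`), which applies verbatim to `kerFib_HQ_rate`.
(v) No infinite-volume limit, no `U ≠ 1` background, no mass gap; constants explode as
`α + γ → 1` (through `aliasConst`), exactly as in the parents.

VERSION v1 (2026-08-19, seat b2b-balaban-t4-ne2-p1-g3): new module answering remark R1 of the
cross-read of the parent (journal C-pv06g15-2); parent `B5Hk163RatePosition` v1 (0991863e6508).
v1.0.1 (same day, same seat): DOCSTRING-ONLY — the DICTIONARY sentence on `Hmod` now says "the
parent's bound for the weighted alias sum" instead of "the weighted alias sum"; code unchanged.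
v1.0.2 (same day, same seat): DOCSTRING-ONLY — near-case wording of `HQ_perturb_le` made exact
(`2Hδ^γ + 4Hδ^γ`, cross-read INFO-1 of C-adv4-87) and the location King p.664 Prop. 3.8 (3.71)
added to the Sources with the explicit non-claim of its decay factor; code unchanged.
-/

namespace Literature.MathematicalPhysics.QuantumFieldTheory.Balaban1983to89.B5Hk163RateQuotient

open scoped BigOperators
open Finset Complex
open Literature.MathematicalPhysics.QuantumFieldTheory.Balaban1983to89.B4Strip
open Literature.MathematicalPhysics.QuantumFieldTheory.Balaban1983to89.B5Prop11Leaves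
open Literature.MathematicalPhysics.QuantumFieldTheory.Balaban1983to89.B5Prop11Fiber
open Literature.MathematicalPhysics.QuantumFieldTheory.Balaban1983to89.B5Hk163Rate
open Literature.MathematicalPhysics.QuantumFieldTheory.Balaban1983to89.B5Hk163RateSum
open Literature.MathematicalPhysics.QuantumFieldTheory.Balaban1983to89.B5Hk163RatePosition
open Literature.MathematicalPhysics.QuantumFieldTheory.King1986

noncomputable section

variable {d : ℕ}

/-! ## 1. The ℓ¹ distance: triangle facts -/

/-- Reverse triangle inequality for the ℓ¹ size: `|‖p‖₁ − ‖q‖₁| ≤ ‖p − q‖₁`. [folklore] -/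
theorem abs_l1_sub_l1_le (p q : Fin d → ℝ) : |l1 p - l1 q| ≤ l1 (p - q) := by
  unfold l1
  rw [← Finset.sum_sub_distrib]
  calc |∑ j, (|p j| - |q j|)| ≤ ∑ j, |(|p j| - |q j|)| := Finset.abs_sum_le_sum_abs _ _
    _ ≤ ∑ j, |p j - q j| := Finset.sum_le_sum fun j _ => abs_abs_sub_abs_le_abs_sub _ _
    _ = ∑ j, |(p - q) j| := Finset.sum_congr rfl fun j _ => by rw [Pi.sub_apply]

/-- Triangle inequality for the ℓ¹ size. [folklore] -/
theorem l1_add_le (u v : Fin d → ℝ) : l1 (u + v) ≤ l1 u + l1 v := by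
  unfold l1
  rw [← Finset.sum_add_distrib]
  exact Finset.sum_le_sum fun j _ => by rw [Pi.add_apply]; exact abs_add_le _ _

/-- The ℓ¹ size is even. [folklore] -/
theorem l1_neg (u : Fin d → ℝ) : l1 (-u) = l1 u := by
  unfold l1
  exact Finset.sum_congr rfl fun j _ => by rw [Pi.neg_apply, abs_neg]

/-- Perturbation of the ℓ¹ distance under a perturbation of both base points:
`|‖x − y‖₁ − ‖x′ − y′‖₁| ≤ ‖x − x′‖₁ + ‖y − y′‖₁` (the ℓ¹ form of King's (4.27)). [folklore] -/
theorem abs_dist_sub_dist_le (x y x' y' : Fin d → ℝ) :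
    |l1 (x - y) - l1 (x' - y')| ≤ l1 (x - x') + l1 (y - y') := by
  have h := abs_l1_sub_l1_le (x - y) (x' - y')
  have e : (x - y) - (x' - y') = (x - x') + (-(y - y')) := by abel
  rw [e] at h
  exact h.trans ((l1_add_le _ _).trans (by rw [l1_neg]))

/-! ## 2. Hölder difference quotients of a Hölder function -/

/-- The `α`-Hölder difference quotient of `f : ℝ^d → ℂ` in the ℓ¹ distance,
`HQ α f x y = ‖x − y‖₁^{−α} · (f x − f y)` (for `x = y` it is `0`). [folklore] -/
def HQ (α : ℝ) (f : (Fin d → ℝ) → ℂ) (x y : Fin d → ℝ) : ℂ :=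
  ((l1 (x - y) ^ (-α) : ℝ) : ℂ) * (f x - f y)

/-- Norm of the Hölder quotient. [folklore] -/
theorem norm_HQ (α : ℝ) (f : (Fin d → ℝ) → ℂ) (x y : Fin d → ℝ) :
    ‖HQ α f x y‖ = l1 (x - y) ^ (-α) * ‖f x - f y‖ := by
  unfold HQ
  rw [norm_mul, Complex.norm_real, Real.norm_of_nonneg (Real.rpow_nonneg (l1_nonneg _) _)]

/-- A `(α + γ)`-Hölder function has `α`-quotients of size `H ‖x − y‖₁^γ`. [folklore] -/
theorem norm_HQ_le {α γ H : ℝ} (hα0 : 0 ≤ α) (hγ : 0 < γ) (hH : 0 ≤ H)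
    {f : (Fin d → ℝ) → ℂ} (hf : ∀ u v, ‖f u - f v‖ ≤ H * l1 (u - v) ^ (α + γ))
    (x y : Fin d → ℝ) : ‖HQ α f x y‖ ≤ H * l1 (x - y) ^ γ := by
  rw [norm_HQ]
  have h0 := l1_nonneg (x - y)
  rcases h0.eq_or_lt with hz | hpos
  · have hn : ‖f x - f y‖ = 0 := by
      refine le_antisymm ?_ (norm_nonneg _)
      have h := hf x y
      rw [← hz, Real.zero_rpow (ne_of_gt (by linarith))] at h
      simpa using h
    rw [hn, mul_zero]
    exact mul_nonneg hH (Real.rpow_nonneg h0 _)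
  · calc l1 (x - y) ^ (-α) * ‖f x - f y‖
        ≤ l1 (x - y) ^ (-α) * (H * l1 (x - y) ^ (α + γ)) :=
          mul_le_mul_of_nonneg_left (hf x y) (Real.rpow_nonneg h0 _)
      _ = H * (l1 (x - y) ^ (-α) * l1 (x - y) ^ (α + γ)) := by ring
      _ = H * l1 (x - y) ^ γ := by
          rw [← Real.rpow_add hpos, show -α + (α + γ) = γ by ring]

/-- The elementary prefactor bound replacing a mean-value estimate: for `0 < b ≤ a` and
`0 ≤ α ≤ 1`, `b^{−α} − a^{−α} ≤ b^{−α} (a − b) / a` (from `t ≤ t^α` on `[0,1]`). [folklore] -/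
theorem rpow_neg_sub_rpow_neg_le {a b α : ℝ} (hb : 0 < b) (hba : b ≤ a) (hα1 : α ≤ 1) :
    b ^ (-α) - a ^ (-α) ≤ b ^ (-α) * (a - b) / a := by
  have ha : 0 < a := hb.trans_le hba
  have ht0 : 0 < b / a := div_pos hb ha
  have ht1 : b / a ≤ 1 := (div_le_one ha).mpr hba
  have hbα : b ^ α ≠ 0 := (Real.rpow_pos_of_pos hb α).ne'
  have haα : a ^ α ≠ 0 := (Real.rpow_pos_of_pos ha α).ne'
  have key : a ^ (-α) = b ^ (-α) * (b / a) ^ α := by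
    rw [Real.div_rpow hb.le ha.le, Real.rpow_neg hb.le, Real.rpow_neg ha.le]
    field_simp
  have hmono : b / a ≤ (b / a) ^ α := by
    have h := Real.rpow_le_rpow_of_exponent_ge ht0 ht1 hα1
    rwa [Real.rpow_one] at h
  have hb0 : 0 ≤ b ^ (-α) := Real.rpow_nonneg hb.le _
  rw [key]
  calc b ^ (-α) - b ^ (-α) * (b / a) ^ α = b ^ (-α) * (1 - (b / a) ^ α) := by ring
    _ ≤ b ^ (-α) * (1 - b / a) := mul_le_mul_of_nonneg_left (by linarith) hb0
    _ = b ^ (-α) * (a - b) / a := by field_simp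

/-- `t^{−α} t^{α} ≤ 1` for `t ≥ 0` (it is `1` for `t > 0` or `α = 0`, and `0` otherwise).
[folklore] -/
theorem rpow_neg_mul_rpow_le_one {t α : ℝ} (ht : 0 ≤ t) : t ^ (-α) * t ^ α ≤ 1 := by
  rcases ht.eq_or_lt with hz | hpos
  · rw [← hz]
    by_cases hα : α = 0
    · simp [hα]
    · rw [Real.zero_rpow hα, mul_zero]; exact zero_le_one
  · rw [← Real.rpow_add hpos, neg_add_cancel, Real.rpow_zero]

/-- Perturbation of the base points of a Hölder quotient (the routine step behind King's
(4.27)/(4.28), here for a general `(α + γ)`-Hölder `f`): if `‖x − x′‖₁, ‖y − y′‖₁ ≤ δ` then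
`‖HQ α f x y − HQ α f x′ y′‖ ≤ 6 H δ^γ`.  Near case `‖x − y‖₁ ≤ 2δ`: the quotients are
`≤ H (2δ)^γ ≤ 2 H δ^γ` and `≤ H (4δ)^γ ≤ 4 H δ^γ` (so the `6` is forced by this case); far case:
the prefactor bound `rpow_neg_sub_rpow_neg_le`, two pieces `≤ 2 H δ^γ` each. [folklore] -/
theorem HQ_perturb_le {α γ H δ : ℝ} (hα0 : 0 ≤ α) (hγ : 0 < γ) (hαγ : α + γ ≤ 1) (hH : 0 ≤ H)
    {f : (Fin d → ℝ) → ℂ} (hf : ∀ u v, ‖f u - f v‖ ≤ H * l1 (u - v) ^ (α + γ))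
    (hδ : 0 < δ) {x y x' y' : Fin d → ℝ} (hx : l1 (x - x') ≤ δ) (hy : l1 (y - y') ≤ δ) :
    ‖HQ α f x y - HQ α f x' y'‖ ≤ 6 * H * δ ^ γ := by
  have hα1 : α ≤ 1 := by linarith
  have hγ1 : γ ≤ 1 := by linarith
  set a := l1 (x - y) with ha_def
  set b := l1 (x' - y') with hb_def
  have ha0 : 0 ≤ a := l1_nonneg _
  have hb0 : 0 ≤ b := l1_nonneg _
  have hab : |a - b| ≤ 2 * δ := by
    have h := abs_dist_sub_dist_le x y x' y'
    linarith
  have hab1 : a - b ≤ 2 * δ := (le_abs_self _).trans hab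
  have hab2 : b - a ≤ 2 * δ := by rw [abs_sub_comm] at hab; exact (le_abs_self _).trans hab
  have hδγ : 0 ≤ δ ^ γ := Real.rpow_nonneg hδ.le _
  have h2γ : (2 : ℝ) ^ γ ≤ 2 := by
    have h := Real.rpow_le_rpow_of_exponent_le (by norm_num : (1 : ℝ) ≤ 2) hγ1
    rwa [Real.rpow_one] at h
  have h4γ : (4 : ℝ) ^ γ ≤ 4 := by
    have h := Real.rpow_le_rpow_of_exponent_le (by norm_num : (1 : ℝ) ≤ 4) hγ1
    rwa [Real.rpow_one] at h
  have hQ : ∀ u v, ‖HQ α f u v‖ ≤ H * l1 (u - v) ^ γ := norm_HQ_le hα0 hγ hH hf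
  by_cases hnear : a ≤ 2 * δ
  · -- near case
    have h1 : ‖HQ α f x y‖ ≤ 2 * H * δ ^ γ := by
      calc ‖HQ α f x y‖ ≤ H * a ^ γ := hQ x y
        _ ≤ H * (2 * δ) ^ γ :=
            mul_le_mul_of_nonneg_left (Real.rpow_le_rpow ha0 hnear hγ.le) hH
        _ = H * (2 ^ γ * δ ^ γ) := by rw [Real.mul_rpow (by norm_num) hδ.le]
        _ ≤ H * (2 * δ ^ γ) :=
            mul_le_mul_of_nonneg_left (mul_le_mul_of_nonneg_right h2γ hδγ) hH
        _ = 2 * H * δ ^ γ := by ring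
    have hb4 : b ≤ 4 * δ := by linarith
    have h2 : ‖HQ α f x' y'‖ ≤ 4 * H * δ ^ γ := by
      calc ‖HQ α f x' y'‖ ≤ H * b ^ γ := hQ x' y'
        _ ≤ H * (4 * δ) ^ γ :=
            mul_le_mul_of_nonneg_left (Real.rpow_le_rpow hb0 hb4 hγ.le) hH
        _ = H * (4 ^ γ * δ ^ γ) := by rw [Real.mul_rpow (by norm_num) hδ.le]
        _ ≤ H * (4 * δ ^ γ) :=
            mul_le_mul_of_nonneg_left (mul_le_mul_of_nonneg_right h4γ hδγ) hH
        _ = 4 * H * δ ^ γ := by ring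
    calc ‖HQ α f x y - HQ α f x' y'‖ ≤ ‖HQ α f x y‖ + ‖HQ α f x' y'‖ := norm_sub_le _ _
      _ ≤ 2 * H * δ ^ γ + 4 * H * δ ^ γ := add_le_add h1 h2
      _ = 6 * H * δ ^ γ := by ring
  · -- far case
    push Not at hnear
    have hapos : 0 < a := by linarith
    have hbpos : 0 < b := by linarith
    have h2δ : 0 < 2 * δ := by linarith
    -- the common tail estimate `2 δ H a^{γ-1} ≤ 2 H δ^γ`
    have haux : 2 * δ * H * a ^ (γ - 1) ≤ 2 * H * δ ^ γ := by
      have h1 : a ^ (γ - 1) ≤ (2 * δ) ^ (γ - 1) :=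
        Real.rpow_le_rpow_of_nonpos h2δ hnear.le (by linarith)
      have h2 : (2 * δ) ^ (γ - 1) = (2 * δ) ^ γ / (2 * δ) := Real.rpow_sub_one h2δ.ne' γ
      have h3 : (2 * δ) ^ γ = 2 ^ γ * δ ^ γ := Real.mul_rpow (by norm_num) hδ.le
      calc 2 * δ * H * a ^ (γ - 1) ≤ 2 * δ * H * (2 * δ) ^ (γ - 1) :=
            mul_le_mul_of_nonneg_left h1 (mul_nonneg h2δ.le hH)
        _ = H * ((2 * δ) * ((2 * δ) ^ γ / (2 * δ))) := by rw [h2]; ring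
        _ = H * (2 * δ) ^ γ := by rw [mul_div_cancel₀ _ h2δ.ne']
        _ = H * (2 ^ γ * δ ^ γ) := by rw [h3]
        _ ≤ H * (2 * δ ^ γ) :=
            mul_le_mul_of_nonneg_left (mul_le_mul_of_nonneg_right h2γ hδγ) hH
        _ = 2 * H * δ ^ γ := by ring
    -- decomposition of the difference
    have hdec : HQ α f x y - HQ α f x' y'
        = ((a ^ (-α) : ℝ) : ℂ) * ((f x - f x') - (f y - f y'))
          + (((a ^ (-α) - b ^ (-α) : ℝ)) : ℂ) * (f x' - f y') := by
      simp only [HQ, ← ha_def, ← hb_def]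
      push_cast
      ring
    -- first term
    have hT1 : ‖((a ^ (-α) : ℝ) : ℂ) * ((f x - f x') - (f y - f y'))‖ ≤ 2 * H * δ ^ γ := by
      rw [norm_mul, Complex.norm_real, Real.norm_of_nonneg (Real.rpow_nonneg ha0 _)]
      have hαγ0 : 0 ≤ α + γ := by linarith
      have hfx : ‖f x - f x'‖ ≤ H * δ ^ (α + γ) :=
        (hf x x').trans (mul_le_mul_of_nonneg_left (Real.rpow_le_rpow (l1_nonneg _) hx hαγ0) hH)
      have hfy : ‖f y - f y'‖ ≤ H * δ ^ (α + γ) :=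
        (hf y y').trans (mul_le_mul_of_nonneg_left (Real.rpow_le_rpow (l1_nonneg _) hy hαγ0) hH)
      have hsum : ‖(f x - f x') - (f y - f y')‖ ≤ 2 * (H * δ ^ (α + γ)) :=
        (norm_sub_le _ _).trans (by linarith)
      have hpre : a ^ (-α) ≤ δ ^ (-α) :=
        Real.rpow_le_rpow_of_nonpos hδ (by linarith) (by linarith)
      calc a ^ (-α) * ‖(f x - f x') - (f y - f y')‖ ≤ δ ^ (-α) * (2 * (H * δ ^ (α + γ))) :=
            mul_le_mul hpre hsum (norm_nonneg _) (Real.rpow_nonneg hδ.le _)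
        _ = 2 * H * (δ ^ (-α) * δ ^ (α + γ)) := by ring
        _ = 2 * H * δ ^ γ := by rw [← Real.rpow_add hδ, show -α + (α + γ) = γ by ring]
    -- second term
    have hfb : ‖f x' - f y'‖ ≤ H * b ^ (α + γ) := hf x' y'
    have hT2 : ‖(((a ^ (-α) - b ^ (-α) : ℝ)) : ℂ) * (f x' - f y')‖ ≤ 2 * H * δ ^ γ := by
      rw [norm_mul, Complex.norm_real, Real.norm_eq_abs]
      rcases le_total b a with hba | hab'
      · -- `b ≤ a`
        have hB := rpow_neg_sub_rpow_neg_le hbpos hba hα1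
        have hnn : 0 ≤ b ^ (-α) - a ^ (-α) :=
          sub_nonneg.mpr (Real.rpow_le_rpow_of_nonpos hbpos hba (by linarith))
        have habs : |a ^ (-α) - b ^ (-α)| = b ^ (-α) - a ^ (-α) := by
          rw [abs_sub_comm]; exact abs_of_nonneg hnn
        have hq0 : 0 ≤ b ^ (-α) * (a - b) / a :=
          div_nonneg (mul_nonneg (Real.rpow_nonneg hb0 _) (sub_nonneg.mpr hba)) ha0
        rw [habs]
        calc (b ^ (-α) - a ^ (-α)) * ‖f x' - f y'‖
            ≤ (b ^ (-α) * (a - b) / a) * (H * b ^ (α + γ)) :=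
              mul_le_mul hB hfb (norm_nonneg _) hq0
          _ = H * ((a - b) / a) * (b ^ (-α) * b ^ (α + γ)) := by ring
          _ = H * ((a - b) / a) * b ^ γ := by
              rw [← Real.rpow_add hbpos, show -α + (α + γ) = γ by ring]
          _ ≤ H * ((2 * δ) / a) * a ^ γ := by
              have h1 : (a - b) / a ≤ (2 * δ) / a := div_le_div_of_nonneg_right hab1 ha0
              have h2 : b ^ γ ≤ a ^ γ := Real.rpow_le_rpow hb0 hba hγ.le
              have h3 : 0 ≤ H * ((2 * δ) / a) := mul_nonneg hH (div_nonneg h2δ.le ha0)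
              exact mul_le_mul (mul_le_mul_of_nonneg_left h1 hH) h2 (Real.rpow_nonneg hb0 _) h3
          _ = 2 * δ * H * (a ^ γ / a) := by ring
          _ = 2 * δ * H * a ^ (γ - 1) := by rw [Real.rpow_sub_one hapos.ne']
          _ ≤ 2 * H * δ ^ γ := haux
      · -- `a ≤ b`
        have hB := rpow_neg_sub_rpow_neg_le hapos hab' hα1
        have hnn : 0 ≤ a ^ (-α) - b ^ (-α) :=
          sub_nonneg.mpr (Real.rpow_le_rpow_of_nonpos hapos hab' (by linarith))
        have habs : |a ^ (-α) - b ^ (-α)| = a ^ (-α) - b ^ (-α) := abs_of_nonneg hnn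
        have hq0 : 0 ≤ a ^ (-α) * (b - a) / b :=
          div_nonneg (mul_nonneg (Real.rpow_nonneg ha0 _) (sub_nonneg.mpr hab')) hb0
        rw [habs]
        calc (a ^ (-α) - b ^ (-α)) * ‖f x' - f y'‖
            ≤ (a ^ (-α) * (b - a) / b) * (H * b ^ (α + γ)) :=
              mul_le_mul hB hfb (norm_nonneg _) hq0
          _ = H * (b - a) * a ^ (-α) * (b ^ (α + γ) / b) := by ring
          _ = H * (b - a) * a ^ (-α) * b ^ (α + γ - 1) := by rw [Real.rpow_sub_one hbpos.ne']
          _ ≤ H * (2 * δ) * a ^ (-α) * a ^ (α + γ - 1) := by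
              have h2 : b ^ (α + γ - 1) ≤ a ^ (α + γ - 1) :=
                Real.rpow_le_rpow_of_nonpos hapos hab' (by linarith)
              have h3 : 0 ≤ a ^ (-α) := Real.rpow_nonneg ha0 _
              have h4 : 0 ≤ H * (2 * δ) * a ^ (-α) := mul_nonneg (mul_nonneg hH h2δ.le) h3
              exact mul_le_mul (mul_le_mul_of_nonneg_right (mul_le_mul_of_nonneg_left hab2 hH) h3)
                h2 (Real.rpow_nonneg hb0 _) h4
          _ = 2 * δ * H * (a ^ (-α) * a ^ (α + γ - 1)) := by ring
          _ = 2 * δ * H * a ^ (γ - 1) := by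
              rw [← Real.rpow_add hapos, show -α + (α + γ - 1) = γ - 1 by ring]
          _ ≤ 2 * H * δ ^ γ := haux
    rw [hdec]
    calc ‖((a ^ (-α) : ℝ) : ℂ) * ((f x - f x') - (f y - f y'))
          + (((a ^ (-α) - b ^ (-α) : ℝ)) : ℂ) * (f x' - f y')‖
        ≤ ‖((a ^ (-α) : ℝ) : ℂ) * ((f x - f x') - (f y - f y'))‖
          + ‖(((a ^ (-α) - b ^ (-α) : ℝ)) : ℂ) * (f x' - f y')‖ := norm_add_le _ _
      _ ≤ 2 * H * δ ^ γ + 2 * H * δ ^ γ := add_le_add hT1 hT2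
      _ ≤ 6 * H * δ ^ γ := by nlinarith [mul_nonneg hH hδγ]

/-! ## 3. Application: the (1.63) kernels across levels `N → R·N` at perturbed base points -/

/-- The level-uniform Hölder constant of `kerFib` at exponent `β` (from `kerFib_holder_le`):
`Hmod d β = 2^{1−β} (C0maj d · π^{1+β} + C1maj d · aliasConst d β)`. [folklore] -/
def Hmod (d : ℕ) (β : ℝ) : ℝ :=
  2 ^ (1 - β) * (C0maj d * (Real.pi * Real.pi ^ β) + C1maj d * aliasConst d β)

/-- `kerFib_holder_le` in the shape `‖K u − K v‖ ≤ Hmod · ‖u − v‖₁^β`. [folklore] -/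
theorem kerFib_holder_le' (hd : 0 < d) {β : ℝ} (hβ0 : 0 ≤ β) (hβ : β < 1) {n : ℕ} [NeZero n]
    (hn : 1 ≤ n) (p : Fin d → ℝ) (hp : ∀ ν, |p ν| ≤ Real.pi) (ν₀ : Fin d) (hν₀ : p ν₀ ≠ 0)
    (μ lam ν : Fin d) (u v : Fin d → ℝ) :
    ‖kerFib n μ lam ν p u - kerFib n μ lam ν p v‖ ≤ Hmod d β * l1 (u - v) ^ β := by
  have h := kerFib_holder_le hd hβ0 hβ hn p hp ν₀ hν₀ μ lam ν u v
  calc ‖kerFib n μ lam ν p u - kerFib n μ lam ν p v‖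
      ≤ 2 ^ (1 - β) * l1 (u - v) ^ β
          * (C0maj d * (Real.pi * Real.pi ^ β) + C1maj d * aliasConst d β) := h
    _ = Hmod d β * l1 (u - v) ^ β := by unfold Hmod; ring

/-- `0 ≤ Hmod d β` for `0 ≤ β < 1` and `0 < d`, read off from `kerFib_holder_le'` at a pair of
points at ℓ¹ distance `1` (so no sign information on `aliasConst` is needed). [folklore] -/
theorem Hmod_nonneg (hd : 0 < d) {β : ℝ} (hβ0 : 0 ≤ β) (hβ : β < 1) : 0 ≤ Hmod d β := by
  set i : Fin d := ⟨0, hd⟩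
  have hp : ∀ ν : Fin d, |(fun _ : Fin d => Real.pi) ν| ≤ Real.pi := fun ν => by
    simp [abs_of_pos Real.pi_pos]
  have hν₀ : (fun _ : Fin d => Real.pi) i ≠ 0 := Real.pi_pos.ne'
  have h := kerFib_holder_le' hd hβ0 hβ (n := 1) le_rfl (fun _ => Real.pi) hp i hν₀ i i i
    (Pi.single i 1) 0
  have hl : l1 (Pi.single i (1 : ℝ) - 0) = 1 := by
    unfold l1
    rw [sub_zero, Finset.sum_eq_single i (fun j _ hj => by simp [hj])
      (fun hi => absurd (Finset.mem_univ i) hi)]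
    simp
  rw [hl, Real.one_rpow, mul_one] at h
  exact (norm_nonneg _).trans h

/-- Nonnegativity of the rate constant `T163(d,α,γ) N^{−γ}`, read off from
`weighted_alias_sum_rate` (whose left side is a sum of nonnegative terms). [folklore] -/
theorem T163_div_nonneg (hd : 0 < d) {α γ : ℝ} (hα0 : 0 ≤ α) (hγ0 : 0 < γ) (hαγ : α + γ < 1)
    {N R : ℕ} [NeZero N] [NeZero R] (hN : 1 ≤ N) (hR : 1 ≤ R)
    (p : Fin d → ℝ) (hp : ∀ ν, |p ν| ≤ Real.pi) (ν₀ : Fin d) (hν₀ : p ν₀ ≠ 0) (μ lam ν : Fin d) :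
    0 ≤ T163 d α γ / (N : ℝ) ^ γ :=
  le_trans (add_nonneg
      (Finset.sum_nonneg fun _ _ =>
        mul_nonneg (norm_nonneg _) (Real.rpow_nonneg (norm_nonneg _) _))
      (Finset.sum_nonneg fun _ _ =>
        mul_nonneg (norm_nonneg _) (Real.rpow_nonneg (norm_nonneg _) _)))
    (weighted_alias_sum_rate hd hα0 hγ0 (by linarith) hαγ hN hR p hp ν₀ hν₀ μ lam ν)

/-- THE LEVEL-DIFFERENCE PART at common base points:
`‖HQ α K^{(N)} (x,y) − HQ α K^{(RN)} (x,y)‖ ≤ 2^{1−α} T163(d,α,γ) N^{−γ}` (`kerFib_rate_holder`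
divided by `‖x − y‖₁^α`; for `x = y` both quotients vanish). [folklore] -/
theorem HQ_kerFib_level_le (hd : 0 < d) {α γ : ℝ} (hα0 : 0 ≤ α) (hγ0 : 0 < γ)
    (hαγ : α + γ < 1) {N R : ℕ} [NeZero N] [NeZero R] (hN : 1 ≤ N) (hR : 1 ≤ R)
    (p : Fin d → ℝ) (hp : ∀ ν, |p ν| ≤ Real.pi) (ν₀ : Fin d) (hν₀ : p ν₀ ≠ 0) (μ lam ν : Fin d)
    (x y : Fin d → ℝ) :
    ‖HQ α (kerFib N μ lam ν p) x y - HQ α (kerFib (R * N) μ lam ν p) x y‖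
      ≤ 2 ^ (1 - α) * (T163 d α γ / (N : ℝ) ^ γ) := by
  have hγ1 : γ ≤ 1 := by linarith
  have hK := kerFib_rate_holder hd hα0 hγ0 hγ1 hαγ hN hR p hp ν₀ hν₀ μ lam ν x y
  have hB0 : 0 ≤ 2 ^ (1 - α) * (T163 d α γ / (N : ℝ) ^ γ) :=
    mul_nonneg (Real.rpow_nonneg (by norm_num) _)
      (T163_div_nonneg hd hα0 hγ0 hαγ hN hR p hp ν₀ hν₀ μ lam ν)
  have e : HQ α (kerFib N μ lam ν p) x y - HQ α (kerFib (R * N) μ lam ν p) x y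
      = -(((l1 (x - y) ^ (-α) : ℝ) : ℂ)
          * ((kerFib (R * N) μ lam ν p x - kerFib N μ lam ν p x)
              - (kerFib (R * N) μ lam ν p y - kerFib N μ lam ν p y))) := by
    unfold HQ; ring
  rw [e, norm_neg, norm_mul, Complex.norm_real,
    Real.norm_of_nonneg (Real.rpow_nonneg (l1_nonneg _) _)]
  calc _ ≤ l1 (x - y) ^ (-α)
          * (2 ^ (1 - α) * l1 (x - y) ^ α * (T163 d α γ / (N : ℝ) ^ γ)) :=
        mul_le_mul_of_nonneg_left hK (Real.rpow_nonneg (l1_nonneg _) _)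
    _ = (l1 (x - y) ^ (-α) * l1 (x - y) ^ α) * (2 ^ (1 - α) * (T163 d α γ / (N : ℝ) ^ γ)) := by
        ring
    _ ≤ 1 * (2 ^ (1 - α) * (T163 d α γ / (N : ℝ) ^ γ)) :=
        mul_le_mul_of_nonneg_right (rpow_neg_mul_rpow_le_one (l1_nonneg _)) hB0
    _ = 2 ^ (1 - α) * (T163 d α γ / (N : ℝ) ^ γ) := one_mul _

/-- THE PACKAGED η-RATE OF HÖLDER QUOTIENTS AT PERTURBED BASE POINTS (the form of King's (4.28)
with (4.27), here in the ℓ¹ distance and for the (1.63) kernels on a fixed non-zero fibre):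
for `0 ≤ α`, `0 < γ`, `α + γ < 1`, `δ > 0` and `‖x − x′‖₁, ‖y − y′‖₁ ≤ δ`,
`‖HQ α K^{(N)} (x,y) − HQ α K^{(RN)} (x′,y′)‖ ≤ 2^{1−α} T163(d,α,γ) N^{−γ} + 6 Hmod(d,α+γ) δ^γ`.
The reader takes `δ = c · N^{−1}` (King: `|x − x′|, |y − y′| ≤ c L^{−k}`), making the right side
`O(N^{−γ})`; no constraint `γ ≤ α` is needed in this formulation. [folklore] -/
theorem kerFib_HQ_rate (hd : 0 < d) {α γ δ : ℝ} (hα0 : 0 ≤ α) (hγ0 : 0 < γ) (hαγ : α + γ < 1)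
    {N R : ℕ} [NeZero N] [NeZero R] (hN : 1 ≤ N) (hR : 1 ≤ R)
    (p : Fin d → ℝ) (hp : ∀ ν, |p ν| ≤ Real.pi) (ν₀ : Fin d) (hν₀ : p ν₀ ≠ 0) (μ lam ν : Fin d)
    (hδ : 0 < δ) {x y x' y' : Fin d → ℝ} (hx : l1 (x - x') ≤ δ) (hy : l1 (y - y') ≤ δ) :
    ‖HQ α (kerFib N μ lam ν p) x y - HQ α (kerFib (R * N) μ lam ν p) x' y'‖
      ≤ 2 ^ (1 - α) * (T163 d α γ / (N : ℝ) ^ γ) + 6 * Hmod d (α + γ) * δ ^ γ := by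
  have hβ0 : 0 ≤ α + γ := by linarith
  have h1 := HQ_kerFib_level_le hd hα0 hγ0 hαγ hN hR p hp ν₀ hν₀ μ lam ν x y
  have hRN : 1 ≤ R * N := one_le_RN hN hR
  have hf : ∀ u v, ‖kerFib (R * N) μ lam ν p u - kerFib (R * N) μ lam ν p v‖
      ≤ Hmod d (α + γ) * l1 (u - v) ^ (α + γ) :=
    fun u v => kerFib_holder_le' hd hβ0 hαγ hRN p hp ν₀ hν₀ μ lam ν u v
  have h2 := HQ_perturb_le hα0 hγ0 hαγ.le (Hmod_nonneg hd hβ0 hαγ) hf hδ hx hy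
  calc ‖HQ α (kerFib N μ lam ν p) x y - HQ α (kerFib (R * N) μ lam ν p) x' y'‖
      ≤ ‖HQ α (kerFib N μ lam ν p) x y - HQ α (kerFib (R * N) μ lam ν p) x y‖
        + ‖HQ α (kerFib (R * N) μ lam ν p) x y - HQ α (kerFib (R * N) μ lam ν p) x' y'‖ :=
          norm_sub_le_norm_sub_add_norm_sub _ _ _
    _ ≤ _ := add_le_add h1 h2

/-- The same with King's choice `δ = c / N` spelled out: the right side is
`(2^{1−α} T163(d,α,γ) + 6 Hmod(d,α+γ) c^γ) · N^{−γ}`. [folklore] -/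
theorem kerFib_HQ_rate_scaled (hd : 0 < d) {α γ c : ℝ} (hα0 : 0 ≤ α) (hγ0 : 0 < γ)
    (hαγ : α + γ < 1) (hc : 0 < c) {N R : ℕ} [NeZero N] [NeZero R] (hN : 1 ≤ N) (hR : 1 ≤ R)
    (p : Fin d → ℝ) (hp : ∀ ν, |p ν| ≤ Real.pi) (ν₀ : Fin d) (hν₀ : p ν₀ ≠ 0) (μ lam ν : Fin d)
    {x y x' y' : Fin d → ℝ} (hx : l1 (x - x') ≤ c / N) (hy : l1 (y - y') ≤ c / N) :
    ‖HQ α (kerFib N μ lam ν p) x y - HQ α (kerFib (R * N) μ lam ν p) x' y'‖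
      ≤ (2 ^ (1 - α) * T163 d α γ + 6 * Hmod d (α + γ) * c ^ γ) / (N : ℝ) ^ γ := by
  have hNpos : (0 : ℝ) < N := by exact_mod_cast hN
  have hδ : 0 < c / N := div_pos hc hNpos
  have h := kerFib_HQ_rate hd hα0 hγ0 hαγ hN hR p hp ν₀ hν₀ μ lam ν hδ hx hy
  have hNγ : 0 < (N : ℝ) ^ γ := Real.rpow_pos_of_pos hNpos _
  calc _ ≤ 2 ^ (1 - α) * (T163 d α γ / (N : ℝ) ^ γ) + 6 * Hmod d (α + γ) * (c / N) ^ γ := h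
    _ = (2 ^ (1 - α) * T163 d α γ + 6 * Hmod d (α + γ) * c ^ γ) / (N : ℝ) ^ γ := by
        rw [Real.div_rpow hc.le hNpos.le]
        field_simp

end

end Literature.MathematicalPhysics.QuantumFieldTheory.Balaban1983to89.B5Hk163RateQuotient
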